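import Literature.NumberTheory.EllipticCurves.PeriodIndexKummerPhi
import Literature.NumberTheory.EllipticCurves.KummerUnramified
import Literature.NumberTheory.Automorphic.GaloisActionPlaces
import Mathlib.FieldTheory.KummerExtension
import HarnessLib

/-!
# Kummer characters vanish on decomposition groups at congruence primes (replacing Hensel)

Topic `NumberTheory/EllipticCurves`; theorems only (no definition, no named fact; D-0026).
The field-to-Galois bridge for the "`≡ 1`" conditions of Clark–Sharif's Lemma 14
((SC3′): "`π_i, π_i' ∈ (K_P)_w^{×P}` … by class field theory `π ≡ 1 (mod 𝔪)`; the condition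
follows from Hensel's Lemma", proof of Lemma 13), in a form that needs neither completions nor
Hensel's lemma and that also covers the primes above `p`:

* `exists_root_valuation_separated` — **valuation separation of the `d`-th roots.** In a
  field `L` with a valuation `v`, a primitive `d`-th root of unity `ζ` and `(d : L) ≠ 0`, if
  `α₀ᵈ = a` with `v(a - 1) < v(d)ᵈ` then some root `α = ζ^{i₀} α₀` has `v(1 - α) < v(d)`
  while every other root `ζʲ α ≠ α` has `v(1 - ζʲ α) ≥ v(d)` (because `1 - a = ∏ (1 - ζⁱ α)`
  and `(1 - ζʲ) ∣ d`); hence (`apply_root_eq_of_valuation_eq`) every `v`-preserving ring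
  endomorphism fixing `ζ` and permuting the roots fixes `α`.
* `exists_root_smul_eq_of_mem_decompositionSubgroup` — for a Galois pair `Ω/k` of a number
  field `k ∋ ζ_d`, `a = 1 + dᵈ t` with `t ∈ w` (`w` a finite place of `k`) and a prime `𝔓` of
  the integral closure of `𝓞 k` in `Ω` above `w`: some `d`-th root `α ∈ Ω` of `a` is fixed by the
  whole decomposition group of `𝔓` in `Gal(Ω/k)` — i.e. `w` splits completely in `k(α)`,
  `a ∈ k_w^{×d}` — by the separation lemma in the number field `k(α)` at the prime below `𝔓`
  (the decomposition group preserves that valuation).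
* `unitChar_eq_zero_of_mem_decompositionSubgroup_of_congr` — the level-field form consumed by
  the proof of Theorem 2: for `k ⊂ K̄` (`K` a number field), `ζ_P ∈ k`, `a ∈ kˣ` with
  `a = 1 + Pᴾ t`, `t ∈ 𝔓 ∩ 𝓞 k`, the Kummer character `f_a` vanishes on `D_𝔓 ∩ Gal(K̄/k)`.

## References

* P. L. Clark, S. Sharif, *Period, index and potential Ш*, Algebra & Number Theory 4 (2010)
  151–174, §3.1 proof of Lemma 13 ((SC3) via congruences) and §3.4 Lemma 14 (`ClarkSharif2010`).
* J. W. S. Cassels, A. Fröhlich (eds.), *Algebraic Number Theory* (1967), Ch. VII §1.1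
  (conjugate places, `|a|_{σw} = |σ⁻¹a|_w`) and Exercise 2.12 (local `n`-th powers `≡ 1`).
-/

noncomputable section

open scoped Classical Pointwise IntermediateField
open NumberField IsDedekindDomain Field Polynomial
open Literature.NumberTheory.GaloisRepresentations Literature.NumberTheory.Automorphic

universe u

namespace Literature.NumberTheory.EllipticCurves

/-! ## Valuation separation of the `d`-th roots of `a ≡ 1` -/

section Separation

variable {L : Type*} [Field L] {Γ₀ : Type*} [LinearOrderedCommGroupWithZero Γ₀]
  (v : Valuation L Γ₀)

/-- `∏_{0 < i < d} (X - ζⁱ) = 1 + X + ⋯ + X^{d-1}` for a primitive `d`-th root of unity `ζ`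
(divide `X^d - 1 = ∏_{i < d} (X - ζⁱ)` by `X - 1`). [folklore] -/
theorem prod_Ico_X_sub_C_pow_eq_geom_sum {d : ℕ} (hd : 0 < d) {ζ : L} (hζ : IsPrimitiveRoot ζ d) :
    ∏ i ∈ Finset.Ico 1 d, (X - C (ζ ^ i)) = ∑ i ∈ Finset.range d, (X : L[X]) ^ i := by
  have h := X_pow_sub_C_eq_prod hζ hd (one_pow d)
  simp only [mul_one, map_one] at h
  have hsplit : ∏ i ∈ Finset.range d, (X - C (ζ ^ i)) =
      (X - 1) * ∏ i ∈ Finset.Ico 1 d, (X - C (ζ ^ i)) := by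
    rw [Finset.range_eq_Ico, Finset.prod_eq_prod_Ico_succ_bot hd (fun i ↦ X - C (ζ ^ i)), pow_zero,
      map_one]
  have hgeom : (∑ i ∈ Finset.range d, (X : L[X]) ^ i) * (X - 1) = X ^ d - 1 := geom_sum_mul X d
  have hX1 : (X - 1 : L[X]) ≠ 0 := X_sub_C_ne_zero 1
  apply mul_left_cancel₀ hX1
  rw [← hsplit, ← h, mul_comm, hgeom]

/-- `∏_{0 < i < d} (1 - ζⁱ) = d` (evaluate the previous identity at `X = 1`). [folklore] -/
theorem prod_Ico_one_sub_pow_eq_natCast {d : ℕ} (hd : 0 < d) {ζ : L} (hζ : IsPrimitiveRoot ζ d) :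
    ∏ i ∈ Finset.Ico 1 d, (1 - ζ ^ i) = (d : L) := by
  have h := congrArg (Polynomial.eval 1) (prod_Ico_X_sub_C_pow_eq_geom_sum hd hζ)
  rw [eval_prod, eval_finsetSum] at h
  simp only [eval_sub, eval_X, eval_C, eval_pow, one_pow, Finset.sum_const, Finset.card_range,
    nsmul_eq_mul, mul_one] at h
  exact h

/-- A root of unity has valuation `1`. [folklore] -/
theorem valuation_eq_one_of_pow_eq_one {d : ℕ} (hd : 0 < d) {ζ : L} (hζ : ζ ^ d = 1) : v ζ = 1 := by
  have h : v ζ ^ d = 1 := by rw [← map_pow, hζ, map_one]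
  rcases lt_trichotomy (v ζ) 1 with hlt | heq | hgt
  · exact absurd h (pow_lt_one₀ zero_le hlt hd.ne').ne
  · exact heq
  · exact absurd h (one_lt_pow₀ hgt hd.ne').ne'

/-- **`v(d) ≤ v(1 - ζʲ)` for `ζʲ ≠ 1`**: `1 - ζʲ` divides `d = ∏_{0<i<d} (1 - ζⁱ)` and all the
factors have valuation `≤ 1`. [folklore] -/
theorem valuation_natCast_le_valuation_one_sub_pow {d : ℕ} (hd : 0 < d) {ζ : L}
    (hζ : IsPrimitiveRoot ζ d) {j : ℕ} (hj : ζ ^ j ≠ 1) : v (d : L) ≤ v (1 - ζ ^ j) := by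
  -- reduce `j` modulo `d`
  have hjmod : ζ ^ j = ζ ^ (j % d) := by
    conv_lhs => rw [← Nat.div_add_mod j d, pow_add, pow_mul, hζ.pow_eq_one, one_pow, one_mul]
  have hj0 : j % d ≠ 0 := by
    intro h0
    apply hj
    rw [hjmod, h0, pow_zero]
  have hmem : j % d ∈ Finset.Ico 1 d :=
    Finset.mem_Ico.mpr ⟨Nat.one_le_iff_ne_zero.mpr hj0, Nat.mod_lt j hd⟩
  have hle1 : ∀ i, v (1 - ζ ^ i) ≤ 1 := fun i ↦ by
    refine le_trans (Valuation.map_sub v 1 (ζ ^ i)) (max_le (by rw [map_one]) ?_)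
    rw [map_pow, valuation_eq_one_of_pow_eq_one v hd hζ.pow_eq_one, one_pow]
  rw [hjmod, ← prod_Ico_one_sub_pow_eq_natCast hd hζ, map_prod,
    ← Finset.mul_prod_erase _ _ hmem]
  calc v (1 - ζ ^ (j % d)) * ∏ i ∈ (Finset.Ico 1 d).erase (j % d), v (1 - ζ ^ i)
      ≤ v (1 - ζ ^ (j % d)) * 1 := by
        refine mul_le_mul_right ?_ _
        exact Finset.prod_le_one' fun i _ ↦ hle1 i
    _ = v (1 - ζ ^ (j % d)) := mul_one _

/-- **Valuation separation of the `d`-th roots of `a ≡ 1`.** If `α₀ᵈ = a`, `ζ` is a primitive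
`d`-th root of unity and `v(a - 1) < v(d)ᵈ`, then for some `i₀` the root `α = ζ^{i₀} α₀` has
`v(1 - α) < v(d)`, and every root `ζʲ α` with `ζʲ ≠ 1` has `v(d) ≤ v(1 - ζʲ α)` ("exactly one
`d`-th root of `a` is `≡ 1`"). [cite: CasselsFrohlichANT1967, Exercise 2.12 (local units ≡ 1 are n-th powers)] -/
theorem exists_root_valuation_separated {d : ℕ} (hd : 0 < d) {ζ : L} (hζ : IsPrimitiveRoot ζ d)
    {α₀ a : L} (hα₀ : α₀ ^ d = a) (ha : v (a - 1) < v (d : L) ^ d) :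
    ∃ i₀ : ℕ, v (1 - ζ ^ i₀ * α₀) < v (d : L) ∧
      ∀ j : ℕ, ζ ^ j ≠ 1 → v (d : L) ≤ v (1 - ζ ^ j * (ζ ^ i₀ * α₀)) := by
  -- `1 - a = ∏_{i<d} (1 - ζⁱ α₀)`
  have hprod : 1 - a = ∏ i ∈ Finset.range d, (1 - ζ ^ i * α₀) := by
    have h := congrArg (Polynomial.eval 1) (X_pow_sub_C_eq_prod hζ hd hα₀)
    rw [eval_prod] at h
    simpa only [eval_sub, eval_pow, eval_X, eval_C, one_pow] using h
  -- some factor has valuation `< v(d)`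
  have hex : ∃ i₀ ∈ Finset.range d, v (1 - ζ ^ i₀ * α₀) < v (d : L) := by
    by_contra hcon
    push Not at hcon
    have hle : v (d : L) ^ d ≤ v (1 - a) := by
      rw [hprod, map_prod]
      calc v (d : L) ^ d = ∏ _i ∈ Finset.range d, v (d : L) := by
            rw [Finset.prod_const, Finset.card_range]
        _ ≤ ∏ i ∈ Finset.range d, v (1 - ζ ^ i * α₀) := Finset.prod_le_prod' hcon
    rw [Valuation.map_sub_swap] at ha
    exact absurd (lt_of_le_of_lt hle ha) (lt_irrefl _)
  obtain ⟨i₀, -, hi₀⟩ := hex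
  refine ⟨i₀, hi₀, fun j hj ↦ ?_⟩
  -- `1 - ζʲ α = (1 - ζʲ) + ζʲ (1 - α)` with `v(ζʲ (1 - α)) < v(d) ≤ v(1 - ζʲ)`
  have hζv : v (ζ ^ j) = 1 := by
    rw [map_pow, valuation_eq_one_of_pow_eq_one v hd hζ.pow_eq_one, one_pow]
  have hlt : v (ζ ^ j * (1 - ζ ^ i₀ * α₀)) < v (1 - ζ ^ j) := by
    rw [map_mul, hζv, one_mul]
    exact lt_of_lt_of_le hi₀ (valuation_natCast_le_valuation_one_sub_pow v hd hζ hj)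
  have heq : 1 - ζ ^ j * (ζ ^ i₀ * α₀) = (1 - ζ ^ j) + ζ ^ j * (1 - ζ ^ i₀ * α₀) := by ring
  rw [heq, Valuation.map_add_eq_of_lt_left _ hlt]
  exact valuation_natCast_le_valuation_one_sub_pow v hd hζ hj

/-- **Descent.** In the situation of `exists_root_valuation_separated`, a ring endomorphism
`σ` of `L` preserving `v` and sending the separated root `α` to `ζʲ α` fixes `α`. [folklore] -/
theorem apply_root_eq_of_valuation_eq {d : ℕ} {ζ α : L} (σ : L →+* L)
    (hσv : ∀ y, v (σ y) = v y) (hsep : v (1 - α) < v (d : L))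
    (hother : ∀ j : ℕ, ζ ^ j ≠ 1 → v (d : L) ≤ v (1 - ζ ^ j * α))
    {j : ℕ} (hσα : σ α = ζ ^ j * α) : σ α = α := by
  by_cases hj : ζ ^ j = 1
  · rw [hσα, hj, one_mul]
  · exfalso
    have h1 : v (1 - σ α) = v (1 - α) := by
      rw [show 1 - σ α = σ (1 - α) by rw [map_sub, map_one], hσv]
    have h2 := hother j hj
    rw [← hσα, h1] at h2
    exact absurd (lt_of_le_of_lt h2 hsep) (lt_irrefl _)

end Separation

/-! ## Galois pairs: a root fixed by the decomposition group -/

section GaloisPair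

variable {k : Type u} [Field k] [NumberField k] {Ω : Type u} [Field Ω] [Algebra k Ω] [IsGalois k Ω]

/-- **A `d`-th root of `a ≡ 1 (mod dᵈ w)` fixed by the decomposition group.** Let `k` be a
number field containing a primitive `d`-th root of unity `ζ`, `Ω/k` Galois, `w` a finite place
of `k`, `a = 1 + dᵈ t ∈ kˣ` with `t ∈ 𝓞 k ∩ w`, `α₀ ∈ Ω` a `d`-th root of `a`, and `𝔓` a prime
of the integral closure `B` of `𝓞 k` in `Ω` above `w`. Then some `d`-th root `α ∈ Ω` of `a` is
fixed by every `σ ∈ Gal(Ω/k)` with `σ • 𝔓 = 𝔓`: in the number field `L = k(α₀)` (normal over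
`k`) at the place `P = 𝔓 ∩ 𝓞 L` one has `v_P(a - 1) ≤ v_P(d)ᵈ · v_P(t) < v_P(d)ᵈ`, so the
roots separate (`exists_root_valuation_separated`), and `σ|_L` preserves `v_P`
(`Literature.NumberTheory.Automorphic.HeightOneSpectrum.valuation_algEquiv_smul`). This is the
elementary substitute for "`a ≡ 1 (mod 𝔪)` ⟹ `a ∈ k_w^{×d}` by Hensel's lemma" in the proof of
Clark–Sharif's Lemmas 13–14. [cite: ClarkSharif2010, §3.1 proof of Lemma 13 ((SC3) by congruence) and Lemma 14] -/
theorem exists_root_smul_eq_of_smul_ideal_eq {d : ℕ} (hd : 0 < d) {ζ : k}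
    (hζ : IsPrimitiveRoot ζ d) {a : k} (ha : a ≠ 0) (w : HeightOneSpectrum (𝓞 k)) (t : 𝓞 k)
    (ht : t ∈ w.asIdeal) (hat : a = 1 + (d : k) ^ d * t) {α₀ : Ω}
    (hα₀ : α₀ ^ d = algebraMap k Ω a) (𝔓 : Ideal (integralClosure (𝓞 k) Ω)) [𝔓.IsPrime]
    [𝔓.LiesOver w.asIdeal] :
    ∃ α : Ω, α ^ d = algebraMap k Ω a ∧ ∀ σ : Ω ≃ₐ[k] Ω, σ • 𝔓 = 𝔓 → σ α = α := by
  classical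
  -- ### the number field `L = k(α₀)`, normal over `k`
  set L : IntermediateField k Ω := k⟮α₀⟯ with hLdef
  have hαint : IsIntegral k α₀ := by
    refine IsIntegral.of_pow hd ?_
    rw [hα₀]
    exact isIntegral_algebraMap
  haveI : FiniteDimensional k L := IntermediateField.adjoin.finiteDimensional hαint
  haveI : Normal k L := normal_adjoin_root hd hζ ha hα₀
  haveI : NumberField L := NumberField.of_module_finite k L
  let αL : L := IntermediateField.AdjoinSimple.gen k α₀
  have hαL : (αL : Ω) = α₀ := rfl
  -- ### the place `P = 𝔓 ∩ 𝓞 L`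
  set ι := ringOfIntegersToIntegralClosure (k := k) (Ω := Ω) L with hιdef
  set P : Ideal (𝓞 L) := 𝔓.comap ι with hPdef
  haveI hPprime : P.IsPrime := Ideal.comap_isPrime ι 𝔓
  haveI hPover : P.LiesOver w.asIdeal := by
    constructor
    change w.asIdeal = Ideal.comap (algebraMap (𝓞 k) (𝓞 L)) (Ideal.comap ι 𝔓)
    rw [Ideal.comap_comap, hιdef, ringOfIntegersToIntegralClosure_comp_algebraMap]
    exact Ideal.LiesOver.over
  have hPne : P ≠ ⊥ := Ideal.ne_bot_of_liesOver_of_ne_bot w.ne_bot P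
  let wP : HeightOneSpectrum (𝓞 L) := ⟨P, hPprime, hPne⟩
  set v := wP.valuation L with hvdef
  -- ### the data in `L`
  have hζL : IsPrimitiveRoot (algebraMap k L ζ) d := hζ.map_of_injective (algebraMap k L).injective
  have hαLd : αL ^ d = algebraMap k L a := by
    apply (algebraMap L Ω).injective
    rw [map_pow, ← IsScalarTower.algebraMap_apply]
    exact hα₀
  have hd0 : ((d : ℕ) : L) ≠ 0 := by exact_mod_cast hd.ne'
  have hvd : v (d : L) ≠ 0 := (Valuation.ne_zero_iff v).mpr hd0
  have htP : algebraMap (𝓞 k) (𝓞 L) t ∈ P := by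
    have h : t ∈ P.under (𝓞 k) := by rw [← hPover.over]; exact ht
    exact Ideal.mem_comap.mp h
  have hvt : v (algebraMap k L (t : k)) < 1 := by
    have e : algebraMap k L (t : k) = algebraMap (𝓞 L) L (algebraMap (𝓞 k) (𝓞 L) t) := by
      rw [← IsScalarTower.algebraMap_apply, ← IsScalarTower.algebraMap_apply]
    rw [e, hvdef, HeightOneSpectrum.valuation_of_algebraMap]
    exact (HeightOneSpectrum.intValuation_lt_one_iff_mem wP _).mpr htP
  have hva : v (algebraMap k L a - 1) < v (d : L) ^ d := by
    have e : algebraMap k L a - 1 = (d : L) ^ d * algebraMap k L (t : k) := by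
      rw [hat, map_add, map_one, map_mul, map_pow, map_natCast, add_sub_cancel_left]
    rw [e, map_mul, map_pow]
    calc v (d : L) ^ d * v (algebraMap k L (t : k)) < v (d : L) ^ d * 1 :=
          mul_lt_mul_of_pos_left hvt (pow_pos (zero_lt_iff.mpr hvd) d)
      _ = v (d : L) ^ d := mul_one _
  -- ### separation of the roots
  obtain ⟨i₀, hsep, hother⟩ := exists_root_valuation_separated v hd hζL hαLd hva
  set α : L := algebraMap k L ζ ^ i₀ * αL with hαdef
  have hαd : α ^ d = algebraMap k L a := by
    rw [hαdef, mul_pow, ← pow_mul, mul_comm i₀ d, pow_mul, hζL.pow_eq_one, one_pow, one_mul, hαLd]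
  refine ⟨(α : Ω), ?_, fun σ hσ ↦ ?_⟩
  · have h1 : ((α : L) : Ω) ^ d = algebraMap L Ω (α ^ d) := by rw [map_pow]; rfl
    rw [h1, hαd, ← IsScalarTower.algebraMap_apply]
  · -- ### descent along `σ|_L`, which fixes the place `P`
    set σL : L ≃ₐ[k] L := AlgEquiv.restrictNormalHom L σ with hσLdef
    have hσL : ∀ x : L, ((σL x : L) : Ω) = σ (x : Ω) := fun x ↦
      AlgEquiv.restrictNormalHom_apply L σ x
    have hσLinv : ∀ x : L, ((σL⁻¹ x : L) : Ω) = σ⁻¹ (x : Ω) := fun x ↦ by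
      rw [hσLdef, ← map_inv]
      exact AlgEquiv.restrictNormalHom_apply L σ⁻¹ x
    have hfixP : σL • wP = wP := by
      apply HeightOneSpectrum.ext
      rw [HeightOneSpectrum.smul_asIdeal]
      ext x
      rw [Ideal.mem_pointwise_smul_iff_inv_smul_mem]
      change σL⁻¹ • x ∈ Ideal.comap ι 𝔓 ↔ x ∈ Ideal.comap ι 𝔓
      rw [Ideal.mem_comap, Ideal.mem_comap]
      have e : ι (σL⁻¹ • x) = σ⁻¹ • ι x := by
        apply Subtype.ext
        rw [coe_ringOfIntegersToIntegralClosure, integralClosure.coe_smul,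
          coe_ringOfIntegersToIntegralClosure, RingOfIntegers.coe_algEquiv_smul]
        exact hσLinv x
      rw [e, ← Ideal.mem_pointwise_smul_iff_inv_smul_mem, hσ]
    have hσv : ∀ y : L, v ((σL : L →+* L) y) = v y := fun y ↦ by
      have h := HeightOneSpectrum.valuation_algEquiv_smul (F := k) σL wP y
      rwa [hfixP] at h
    -- `σ α` is a root of unity times `α`
    obtain ⟨j, -, hj⟩ := exists_algEquiv_apply_eq_pow_mul hd hζ ha (α := α) hαd σL
    have key := apply_root_eq_of_valuation_eq v (σL : L →+* L) hσv hsep hother (j := j)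
      (by
        change σL α = _
        rw [hj])
    have h2 : σ (α : Ω) = ((σL α : L) : Ω) := (hσL α).symm
    rw [h2]
    exact congrArg Subtype.val key

end GaloisPair

/-! ## The level field: Kummer characters vanish on decomposition groups -/

section LevelField

variable {K : Type u} [Field K] [NumberField K] {k : IntermediateField K (AlgebraicClosure K)}
  {P : ℕ} [NeZero P] {ζ : AlgebraicClosure K}

/-- **A `P`-th root of `a ≡ 1 (mod Pᴾ 𝔓)` fixed by `D_𝔓 ∩ Gal(K̄/k)`.** Let `k ⊂ K̄` be finite
over the number field `K` with `ζ_P ∈ k`, `𝔓` a prime of `\bar ℤ_K` meeting `𝓞 k`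
non-trivially, and `a ∈ kˣ` with `a = 1 + Pᴾ t`, `t ∈ 𝓞 k ∩ 𝔓`. Then some `P`-th root `α ∈ K̄`
of `a` is fixed by every `σ ∈ Gal(K̄/k)` stabilising `𝔓` (the Galois pair `K̄/k`,
`exists_root_smul_eq_of_smul_ideal_eq`): the Galois form of "`a ∈ k_w^{×P}`" for the prime `w`
of `k` below `𝔓`. [cite: ClarkSharif2010, §3.1 proof of Lemma 13 and §3.4 (SC3′)] -/
theorem exists_root_smul_eq_of_mem_decompositionSubgroup [NumberField k]
    (hζ : IsPrimitiveRoot ζ P) (hζk : ζ ∈ k) (a : (↥k)ˣ)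
    {𝔓 : Ideal (absIntegers (𝓞 K) K)} [𝔓.IsPrime]
    (h𝔓 : 𝔓.comap (ringOfIntegersToIntegralClosure (k := K) (Ω := AlgebraicClosure K) k) ≠ ⊥)
    (t : 𝓞 k) (ht : ringOfIntegersToIntegralClosure (k := K) (Ω := AlgebraicClosure K) k t ∈ 𝔓)
    (hat : ((a : k) : AlgebraicClosure K) = 1 + (P : AlgebraicClosure K) ^ P * ((t : k) : _)) :
    ∃ α : AlgebraicClosure K, α ^ P = ((a : k) : AlgebraicClosure K) ∧
      ∀ σ ∈ 𝔓.decompositionSubgroup (absoluteGaloisGroup K), σ ∈ fixingGal k → σ • α = α := by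
  haveI : IsGalois K (AlgebraicClosure K) := {}
  haveI : IsGalois k (AlgebraicClosure K) := IsGalois.tower_top_intermediateField (K := k)
  have hP : 0 < P := NeZero.pos P
  -- the identity of `K̄` between the two rings of algebraic integers
  set ik := ringOfIntegersToIntegralClosure (k := K) (Ω := AlgebraicClosure K) k with hik
  let g : integralClosure (𝓞 k) (AlgebraicClosure K) →+* absIntegers (𝓞 K) K :=
    (Subalgebra.val _).toRingHom.codRestrict (absIntegers (𝓞 K) K).toSubring fun x ↦ by
      change (x : AlgebraicClosure K) ∈ integralClosure (𝓞 K) (AlgebraicClosure K)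
      rw [mem_integralClosure_iff]
      have hZ : IsIntegral ℤ (x : AlgebraicClosure K) := isIntegral_trans _ x.2
      exact hZ.tower_top
  have hg : ∀ x, ((g x : absIntegers (𝓞 K) K) : AlgebraicClosure K) = x := fun x ↦ rfl
  -- the primes
  set 𝔓' : Ideal (integralClosure (𝓞 k) (AlgebraicClosure K)) := 𝔓.comap g with h𝔓'
  haveI : 𝔓'.IsPrime := Ideal.comap_isPrime _ _
  let w : HeightOneSpectrum (𝓞 k) := ⟨𝔓.comap ik, Ideal.comap_isPrime _ _, h𝔓⟩
  haveI : 𝔓'.LiesOver w.asIdeal := by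
    refine ⟨?_⟩
    ext x
    change x ∈ Ideal.comap ik 𝔓 ↔ x ∈ Ideal.comap (algebraMap (𝓞 k) _) (Ideal.comap g 𝔓)
    rw [Ideal.mem_comap, Ideal.mem_comap, Ideal.mem_comap]
    exact Iff.of_eq (congrArg (· ∈ 𝔓) (Subtype.ext rfl))
  -- the data in `k`
  have hζk' : IsPrimitiveRoot (⟨ζ, hζk⟩ : k) P :=
    IsPrimitiveRoot.of_map_of_injective (f := algebraMap k (AlgebraicClosure K)) (by exact hζ)
      (algebraMap k (AlgebraicClosure K)).injective
  have ha0 : (a : k) ≠ 0 := Units.ne_zero a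
  have htw : t ∈ w.asIdeal := Ideal.mem_comap.mpr ht
  have hat' : (a : k) = 1 + (P : k) ^ P * (t : k) := by
    apply (algebraMap k (AlgebraicClosure K)).injective
    rw [map_add, map_one, map_mul, map_pow, map_natCast]
    exact hat
  have hα₀ : pthRoot P ((a : k) : AlgebraicClosure K) ^ P =
      algebraMap k (AlgebraicClosure K) (a : k) := pthRoot_pow P _
  obtain ⟨α, hαP, hfix⟩ :=
    exists_root_smul_eq_of_smul_ideal_eq hP hζk' ha0 w t htw hat' hα₀ 𝔓'
  refine ⟨α, hαP, fun σ hσD hσk ↦ ?_⟩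
  -- `σ` as an automorphism over `k`, stabilising `𝔓'`
  set σk : AlgebraicClosure K ≃ₐ[k] AlgebraicClosure K :=
    IntermediateField.fixingSubgroupEquiv k ⟨σ, hσk⟩ with hσkdef
  have hσk_apply : ∀ x, σk x = σ • x := fun x ↦ rfl
  have hσkinv_apply : ∀ x, σk⁻¹ x = σ⁻¹ • x := fun x ↦ by
    rw [hσkdef, ← map_inv]
    rfl
  have hσ𝔓 : σ • 𝔓 = 𝔓 := (Ideal.mem_decompositionSubgroup_iff).mp hσD
  have hσ𝔓' : σk • 𝔓' = 𝔓' := by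
    ext y
    rw [Ideal.mem_pointwise_smul_iff_inv_smul_mem, h𝔓', Ideal.mem_comap, Ideal.mem_comap]
    have e : g (σk⁻¹ • y) = σ⁻¹ • g y := by
      apply Subtype.ext
      rw [hg, integralClosure.coe_smul, integralClosure.coe_smul, hg]
      exact hσkinv_apply y
    rw [e, ← Ideal.mem_pointwise_smul_iff_inv_smul_mem, hσ𝔓]
  have h := hfix σk hσ𝔓'
  rwa [hσk_apply] at h

/-- **Kummer characters vanish on `D_𝔓 ∩ Gal(K̄/k)` at congruence primes** ((SC3′) in Galois
form: "`π ≡ 1 (mod 𝔪)` … the condition follows", here without Hensel's lemma): with the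
hypotheses of `exists_root_smul_eq_of_mem_decompositionSubgroup`, `f_a(σ) = 0` for every
`σ ∈ D_𝔓 ∩ 𝔤_k`. [cite: ClarkSharif2010, §3.1 proof of Lemma 13 and §3.4 Lemma 14 (SC3′)] -/
theorem unitChar_eq_zero_of_mem_decompositionSubgroup_of_congr [NumberField k]
    (hζ : IsPrimitiveRoot ζ P) (hζk : ζ ∈ k) (a : (↥k)ˣ)
    {𝔓 : Ideal (absIntegers (𝓞 K) K)} [𝔓.IsPrime]
    (h𝔓 : 𝔓.comap (ringOfIntegersToIntegralClosure (k := K) (Ω := AlgebraicClosure K) k) ≠ ⊥)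
    (t : 𝓞 k) (ht : ringOfIntegersToIntegralClosure (k := K) (Ω := AlgebraicClosure K) k t ∈ 𝔓)
    (hat : ((a : k) : AlgebraicClosure K) = 1 + (P : AlgebraicClosure K) ^ P * ((t : k) : _))
    {σ : absoluteGaloisGroup K} (hσD : σ ∈ 𝔓.decompositionSubgroup (absoluteGaloisGroup K))
    (hσk : σ ∈ fixingGal k) : unitChar P ζ a ⟨σ, hσk⟩ = 0 := by
  obtain ⟨α, hαP, hfix⟩ := exists_root_smul_eq_of_mem_decompositionSubgroup hζ hζk a h𝔓 t ht hat
  refine unitChar_eq_of_smul_eq hζ hζk a ⟨σ, hσk⟩ hαP ?_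
  rw [rootPow_zero, one_mul]
  exact hfix σ hσD hσk

end LevelField



end Literature.NumberTheory.EllipticCurves
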